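/-
COR-CM (cell pub-hodgecm2, stage 2 of the Hodge ladder) — TRANSPOSITION SURGE, item (vi) pinning record, binder `hComp`
(REACH half), TEAM hComp row U4′b of `HOME/pinning/HCOMP-TABLE.md` v1: the PER-COMPONENT BALL UNIFORMISATION DATUM of a
complex algebraic model of `Sh_K(ℂ)` — holomorphy along the open immersion, algebraic half, packaging.  Bytes drafted by
prover-pub-hodgecm2-hcomp-compare-2-0 (`hcomp-compare-2`, offer INBOX 2026-08-21 19:23Z); writer of record of this path per
the table = `hcomp-shimura` unless the hcomp-lead re-points (the filing line says who filed).  THEOREMS ONLY: no definition,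
no instance, no named fact, nothing asserted; every landed file untouched.  FRAMING: HC_CM is NOT proved; nothing here
discharges `hComp`/`hUnif`.
-/
import Summits.HodgeConjecture.CorCM.B01.Transposition.HComp.ComponentBallDatumTop
import Literature.NumberTheory.Automorphic.PicardCMUniverse
import HarnessLib

/-!
# The ball uniformisation datum of one component of a complex model of `Sh_K(U(H), 𝔹²)(ℂ)`

Sequel of `HComp/ComponentBallDatumTop.lean` (`exists_pieceUnif`: the uniformisation `unif : ℂ³ → E(ℂ)` of a component
`ι : E ⟶ X`, `φ : E(ℂ) ≃ₜ Δ\𝔹²`, with its four topological clauses and the hinge `ι ∘ unif = u`).  Here: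

* `evalOrZero_appIso_inv_map`, `pt_map_mem_image_iff` — values / membership of complex points along an OPEN IMMERSION
  (sections of `E` over `U` ↔ sections of `X` over `ι(U)` by Mathlib `Scheme.Hom.appIso`; tree
  `AlgPoints.preimage_map_basicSet_image`, SGA1 XII Thm. 1.1 proof a));
* `exists_mem_map_matrix_iff` — reading `∃ γ ∈ Γ, P(γ^f)` in the image subgroup `f(Γ) ≤ GL₃(ℂ)`;
* **`exists_pieceBallDatum`** — for `H` hermitian anisotropic of signature `(2,1)` at `τ` and definite elsewhere, `Γ` a
  torsion-free congruence subgroup of `U(H)(L⁺)`, `ι : E ⟶ X` an open immersion of a smooth projective surface with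
  `φ : E(ℂ) ≃ₜ Δ\𝔹²`, and `u : ℂ³ → X(ℂ)` as in the record's clause `hol` (`u(T·(z,1)) = ι(φ⁻¹[z])`, homogeneous on the cone,
  HOLOMORPHIC in the algebraic coordinates of `X`): `∃ B : UnitaryBallUniformisationDatum 2 E` with `B.E = τ(L)`,
  `B.Hℂ = H^τ`, `B.Γ^{τ₁} = Γ^τ` and `B.unif (T·(z,1)) = φ⁻¹[z]` — algebraic half = the tree's `PicardCode.ofHermitian τ H Γ …`
  (the code of the tree surface `P_Γ(V)`, `Model.pmsCode`), so `UnitaryBallModelUnique.exists_iso_of_eq` applies downstream.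

Consumers (row U5, pin-1): `Γ := U(V)(F⁺) ∩ g_qKg_q⁻¹` (`UnitaryGroup.arithmeticLevel … (K.map (MulAut.conj g_q))`, a
`Level V` by `CorCM/Geometry/LevelConjugate.lean`), `(E, ι, φ) := ` the `q`-th component of
`X := (Motives.baseChangeHom ι₁).obj (S.M.obj K)` (`Deligne1979.exists_components_homeomorph_ballQuotient` with
`e := (S.pts K) ∘ (AlgPoints.baseChangeEquiv ι₁ _)⁻¹`), `u :=` the witness of `S.hol K g_q` (record
`UnitaryCanonicalModel.RecordSystem`, `UnitaryShimuraCanonicalModel.lean`).  Everything below is PROVED; 0 hypothesis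
binders of Prop-valued named facts (T5: n/a).

References: P. Deligne, *Variétés de Shimura*, Proc. Symp. Pure Math. 33.2 (1979), 2.1.2; J. S. Milne, *Introduction to Shimura
varieties* (2005), Lemma 5.13; N. Bergeron, J. Millson, C. Moeglin, Acta Math. 216 (2016), Introduction §1.1, Part 2 §§1.1–1.4;
A. Grothendieck, M. Raynaud, SGA 1, Exp. XII, Thm. 1.1.
-/

set_option autoImplicit false

noncomputable section

open scoped Matrix Topology ComplexOrder
open Set Function MulAction Matrix NumberField
open Literature.Geometry.ComplexHyperbolic
open Literature.Geometry.ComplexHyperbolic.BallModel (U21 Ball proj lift mat x₀)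
open Literature.NumberTheory.Automorphic
open Literature.NumberTheory.Automorphic.UnitaryGroup
open Literature.AlgebraicGeometry.ShimuraVarieties (negCone mem_negCone_iff isOpen_negCone smul_mem_negCone)
open Literature.AlgebraicGeometry.Motives (SchemeOver ComplexPoints AlgPoints)
open Summit.HodgeConjecture.CorCM.FramedCone

namespace Summit.HodgeConjecture.CorCM.HComp

variable (L : Type) [Field L] [NumberField L] [IsCMField L] (H : Matrix (Fin 3) (Fin 3) L)
  (τ : L →+* ℂ) (T : GL (Fin 3) ℂ) (hT : formCongr (starRingEnd ℂ) T (H.map τ) = BallModel.J)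
  {Γ : Subgroup (GL (Fin 3) L)}

/-! ## 4. The ball datum of a component (row U4′b): holomorphy along the open immersion; algebraic half by
`PicardCode.ofHermitian` -/

section Datum

open Literature.AlgebraicGeometry.ShimuraVarieties (hermForm signatureMatrix IsCongruenceSubgroup
  UnitaryBallUniformisationDatum unitaryGroup_eq_unitaryGroupOfForm)
open Literature.AlgebraicGeometry.Motives (IsSmoothProjective)
open Literature.NumberTheory.Automorphic.PicardCM (PicardCode)
open AlgebraicGeometry CategoryTheory Opposite

/-- **Evaluation of regular functions commutes with an open immersion** `ι : E ⟶ X` of complex schemes: for an open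
`U ⊆ E`, a section `s ∈ Γ(E, U)` and a complex point `P` of `E`, the value at `ι(P)` of the section of `X` over `ι(U)`
corresponding to `s` (Mathlib `Scheme.Hom.appIso`) is the value of `s` at `P` (total evaluations `AlgPoints.evalOrZero`,
junk `0` off `U`; tree `AlgPoints.preimage_map_basicSet_image`, SGA1 XII Thm. 1.1 proof a)). [folklore] -/
theorem evalOrZero_appIso_inv_map {X E : SchemeOver ℂ} (ι : E ⟶ X) [IsOpenImmersion ι.left]
    (U : E.left.Opens) (s : E.left.presheaf.obj (op U)) (P : ComplexPoints E) :
    AlgPoints.evalOrZero (ι.left ''ᵁ U) ((ι.left.appIso U).inv s) (AlgPoints.map ι P) =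
      AlgPoints.evalOrZero U s P := by
  by_cases h : P.pt ∈ U
  · have hmem : P ∈ AlgPoints.basicSet U s {AlgPoints.evalOrZero U s P} :=
      ⟨h, by rw [AlgPoints.evalOrZero_of_mem s h]; rfl⟩
    rw [← AlgPoints.preimage_map_basicSet_image ι U s] at hmem
    obtain ⟨h', hval⟩ := hmem
    rw [AlgPoints.evalOrZero_of_mem _ h']
    exact hval
  · have h' : (AlgPoints.map ι P).pt ∉ ι.left ''ᵁ U := fun h' => h (by
      rw [← ι.left.preimage_image_eq U]; exact h')
    rw [AlgPoints.evalOrZero_of_not_mem _ h', AlgPoints.evalOrZero_of_not_mem _ h]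

/-- The point of `ι(P)` lies in `ι(U)` iff the point of `P` lies in `U` (`ι` an open immersion, injective on points;
Mathlib `Scheme.Hom.preimage_image_eq`). [folklore] -/
theorem pt_map_mem_image_iff {X E : SchemeOver ℂ} (ι : E ⟶ X) [IsOpenImmersion ι.left] (U : E.left.Opens)
    (P : ComplexPoints E) : (AlgPoints.map ι P).pt ∈ ι.left ''ᵁ U ↔ P.pt ∈ U := by
  constructor
  · intro h
    rw [← ι.left.preimage_image_eq U]
    exact h
  · intro h
    have h' : P.pt ∈ ι.left ⁻¹ᵁ (ι.left ''ᵁ U) := by rw [ι.left.preimage_image_eq U]; exact h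
    exact h'

/-- Reading a group `Γ ≤ GL₃(R)` through a ring map `f : R → ℂ`: a predicate holds at `γ^f` for some `γ ∈ Γ` iff it holds at
some element of the image subgroup `f(Γ) ≤ GL₃(ℂ)`. [folklore] -/
theorem exists_mem_map_matrix_iff {R : Type*} [CommRing R] (f : R →+* ℂ) (Γ : Subgroup (GL (Fin 3) R))
    (P : Matrix (Fin 3) (Fin 3) ℂ → Prop) :
    (∃ γ ∈ Γ, P ((γ : Matrix (Fin 3) (Fin 3) R).map f)) ↔
      ∃ g ∈ Γ.map (Matrix.GeneralLinearGroup.map f), P (g : Matrix (Fin 3) (Fin 3) ℂ) := by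
  have hm : ∀ γ : GL (Fin 3) R, ((Matrix.GeneralLinearGroup.map f γ : GL (Fin 3) ℂ) : Matrix (Fin 3) (Fin 3) ℂ) =
      (γ : Matrix (Fin 3) (Fin 3) R).map f :=
    fun γ ↦ Matrix.ext fun i j ↦ Matrix.GeneralLinearGroup.map_apply _ _ _ _
  constructor
  · rintro ⟨γ, hγ, h⟩
    exact ⟨Matrix.GeneralLinearGroup.map f γ, Subgroup.mem_map_of_mem _ hγ, by rw [hm]; exact h⟩
  · rintro ⟨g, hg, h⟩
    obtain ⟨γ, hγ, rfl⟩ := Subgroup.mem_map.1 hg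
    exact ⟨γ, hγ, by rw [← hm]; exact h⟩

/-- **The ball uniformisation datum of one component of a complex model of `Sh_K(ℂ)`** (row U4′b).  In the setting of
`exists_pieceUnif` assume moreover: `H` hermitian for the CM conjugation, anisotropic, positive definite at the complex
embeddings off the place of `τ`; `Γ` a torsion-free CONGRUENCE subgroup of `U(H)(L⁺)` (for the pieces of `Sh_K(ℂ)`:
`Γ = U(H)(L⁺) ∩ gKg⁻¹`, congruence by `UnitaryGroup.isCongruenceSubgroup_arithmeticLevel_of_isOpen`, torsion-free = the
small-level hypothesis of `UnitaryCanonicalModel.exists_recordSystem`); `ι : E ⟶ X` an OPEN IMMERSION of a smooth projective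
surface (`Deligne1979.exists_components_homeomorph_ballQuotient`); and the third conjunct of the record's clause `hol`:
`v ↦ f(u v)` is complex differentiable on the part of the cone above every affine open `U ⊆ X`, for every `f ∈ Γ(X, U)`.
Then `E` carries a `UnitaryBallUniformisationDatum 2 E` (the tree's structure, BMM Introduction §1.1 / Part 2 §§1.1–1.4) with
field `τ(L) ⊂ ℂ`, complex Gram matrix `H^τ`, group `Γ^τ` (read in `GL₃(ℂ)`), and uniformisation pinned by
`unif (T·(z,1)) = φ⁻¹[z]`.  ALGEBRAIC HALF = the tree's code `PicardCode.ofHermitian τ H Γ …` verbatim (field, Gram matrix,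
group transported along `τ.rangeRestrictFieldEquiv`; `ofHermitian_H_map`, `ofHermitian_Γ_map`, anisotropy by
`isAnisotropic_ofHermitian_iff`) — the SAME code as the tree surface `P_Γ(V)` (`Model.pmsCode`), so that
`UnitaryBallModelUnique.exists_iso_of_eq` applies downstream; TOPOLOGICAL HALF = `exists_pieceUnif`; HOLOMORPHY: the record's
differentiability on `X` moved along `ι` — affine opens of `E` are affine opens of `X`
(`IsAffineOpen.image_of_isOpenImmersion`), sections correspond by `Scheme.Hom.appIso`, values agree
(`evalOrZero_appIso_inv_map`), and `ι ∘ unif = u` on the cone.  No canonical model, reciprocity or properness is used;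
nothing is asserted beyond the displayed hypotheses. [cite: Deligne1979ShimuraVarieties, §2.1.2]
[cite: BergeronMillsonMoeglin2016Balls, Introduction §1.1 and Part 2 §§1.1–1.4] [cite: Milne2005ShimuraVarieties, Lemma 5.13] -/
theorem exists_pieceBallDatum
    (hH : ∀ i j, cmConjRingHom L (H i j) = H j i)
    (hanis : ∀ v : Fin 3 → L, hermForm (cmConjRingHom L) H v v = 0 → v = 0)
    (hpos : ∀ τ' : L →+* ℂ, InfinitePlace.mk τ' ≠ InfinitePlace.mk τ → (H.map τ').PosDef)
    (hcong : IsCongruenceSubgroup (cmConjRingHom L) H Γ) (htf : ∀ γ ∈ Γ, IsOfFinOrder γ → γ = 1)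
    {X E : SchemeOver ℂ} (ι : E ⟶ X) [IsOpenImmersion ι.left] (hE : IsSmoothProjective 2 E)
    (φ : ComplexPoints E ≃ₜ orbitRel.Quotient (archImageU21 L H τ T hT Γ) Ball)
    (u : (Fin 3 → ℂ) → ComplexPoints X)
    (hu₁ : ∀ z : Ball, u ((T : Matrix (Fin 3) (Fin 3) ℂ) *ᵥ lift z) = AlgPoints.map ι (φ.symm (Quotient.mk'' z)))
    (hu₂ : ∀ v ∈ negCone (H.map τ), ∀ c : ℂ, c ≠ 0 → u (c • v) = u v)
    (hu₃ : ∀ (U : X.left.affineOpens) (f : X.left.presheaf.obj (op (U : X.left.Opens))),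
      DifferentiableOn ℂ (fun v ↦ AlgPoints.evalOrZero (U : X.left.Opens) f (u v))
        (negCone (H.map τ) ∩ u ⁻¹' {P | P.pt ∈ (U : X.left.Opens)})) :
    ∃ B : UnitaryBallUniformisationDatum 2 E,
      B.E = τ.fieldRange ∧ B.Hℂ = H.map τ ∧
        B.Γ.map (Matrix.GeneralLinearGroup.map (B.τ₁ : B.E →+* ℂ)) = Γ.map (Matrix.GeneralLinearGroup.map τ) ∧
          ∀ z : Ball, B.unif ((T : Matrix (Fin 3) (Fin 3) ℂ) *ᵥ lift z) = φ.symm (Quotient.mk'' z) := by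
  classical
  -- `Γ ≤ U(H)(L⁺)`
  have hΓ : Γ ≤ rational (↥(maximalRealSubfield L)) L (IsCMField.complexConj L) 3 H := by
    intro γ hγ
    have h := hcong.1 hγ
    rw [unitaryGroup_eq_unitaryGroupOfForm] at h
    exact h
  obtain ⟨unif, h1, h2, h3, h4, h5, h6⟩ := exists_pieceUnif L H τ T hT hΓ ι φ u hu₁ hu₂
  have hSig : ∃ T' : GL (Fin 3) ℂ,
      (T' : Matrix (Fin 3) (Fin 3) ℂ)ᴴ * H.map τ * (T' : Matrix (Fin 3) (Fin 3) ℂ) = signatureMatrix 2 :=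
    ⟨T, by rw [UnitaryBallUniformisationDatum.signatureMatrix_two]; exact frame_J_of_formCongr L H τ T hT⟩
  -- the code of `(L, τ, H, Γ)` (field `τ(L)`, Gram matrix and group transported) and its read-outs
  obtain ⟨cd, hcdE, hHc, hΓc, hanis'⟩ : ∃ cd : PicardCode, cd.E = τ.fieldRange ∧ cd.H.map cd.E.subtype = H.map τ ∧
      cd.Γ.map (Matrix.GeneralLinearGroup.map (cd.E.subtype : cd.E →+* ℂ)) = Γ.map (Matrix.GeneralLinearGroup.map τ) ∧
      cd.IsAnisotropic :=
    ⟨PicardCode.ofHermitian τ H Γ hH hSig hpos hcong htf, rfl,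
      PicardCode.ofHermitian_H_map τ H Γ hH hSig hpos hcong htf,
      PicardCode.ofHermitian_Γ_map τ H Γ hH hSig hpos hcong htf,
      (PicardCode.isAnisotropic_ofHermitian_iff τ H Γ hH hSig hpos hcong htf).mpr hanis⟩
  refine ⟨
    { E := cd.E, H := cd.H, conj_H_apply := cd.conj_H_apply, anisotropic := hanis',
      signature_τ₁ := cd.signature, posDef_of_ne := cd.posDef_of_ne, Γ := cd.Γ,
      isCongruenceSubgroup := cd.isCongruenceSubgroup, torsionFree := cd.torsionFree, unif := unif,
      continuousOn_unif := by rw [hHc]; exact h3,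
      isOpenMap_unif := by rw [hHc]; exact h4,
      surjOn_unif := by rw [hHc]; exact h5,
      unif_eq_unif_iff := ?_,
      differentiableOn_unif := ?_,
      isSmoothProjective := hE }, hcdE, hHc, hΓc, h1⟩
  · -- fibres: the group read through `τ(L) ⊂ ℂ`
    intro v hv w hw
    rw [hHc] at hv hw
    rw [h6 v hv w hw,
      exists_mem_map_matrix_iff τ Γ (fun g => ∃ c : ℂ, c ≠ 0 ∧ g *ᵥ v = c • w), ← hΓc,
      ← exists_mem_map_matrix_iff (cd.E.subtype : cd.E →+* ℂ) cd.Γ (fun g => ∃ c : ℂ, c ≠ 0 ∧ g *ᵥ v = c • w)]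
  · -- holomorphy in the algebraic coordinates of `E`, from that of `u` in those of `X`
    intro U s
    rw [hHc]
    have hU' : IsAffineOpen (ι.left ''ᵁ (U : E.left.Opens)) := U.2.image_of_isOpenImmersion ι.left
    have hd := hu₃ ⟨ι.left ''ᵁ (U : E.left.Opens), hU'⟩ ((ι.left.appIso (U : E.left.Opens)).inv s)
    refine (hd.mono ?_).congr ?_
    · rintro v ⟨hv, hvU⟩
      refine ⟨hv, ?_⟩
      show (u v).pt ∈ ι.left ''ᵁ (U : E.left.Opens)
      rw [← h2 v hv, pt_map_mem_image_iff]
      exact hvU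
    · rintro v ⟨hv, -⟩
      show AlgPoints.evalOrZero (U : E.left.Opens) s (unif v) =
        AlgPoints.evalOrZero (ι.left ''ᵁ (U : E.left.Opens)) ((ι.left.appIso (U : E.left.Opens)).inv s) (u v)
      rw [← h2 v hv, evalOrZero_appIso_inv_map]

end Datum

end Summit.HodgeConjecture.CorCM.HComp

end
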